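import Literature.Analysis.FluidPDE.DissipationAnomaly
import HarnessLib

/-!
# Barrier (AnomalousDissipation): codimension-one rigidity — divergence-free `BV ∩ L^∞` fields
carry no Duchon–Robert dissipation (De Rosa–Inversi 2024)

D-0021 barrier catalogue for `Summits/AnomalousDissipation` (summit statement
`AnomalousDissipation := Literature.Turb.ZerothLaw`), cite item wi-17539 (catalogue gap found by the
mechanism hunt of 2026-08-15).

L. De Rosa, M. Inversi, *Dissipation in Onsager's critical classes and energy conservation in
`BV ∩ L^∞` with and without boundary*, Comm. Math. Phys. 405 (2024) (arXiv:2307.09189, read at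
§1.1–1.2, Thm. 1.1, **Thm. 1.2**, Rem. after Thm. 1.2, §2.6, §4): for a divergence-free field
`u : Ω × (0,T) → ℝ^d` with `u ∈ L¹(I; BV(O)) ∩ L^∞(I × O)` for all `I ⊂⊂ (0,T)`, `O ⊂⊂ Ω`, and any
weak (measure) limit `D[u]` of the Duchon–Robert approximations
`D_ε[u] = (4ε)⁻¹ ∫ ∇ρ(z) · δ_{εz}u |δ_{εz}u|² dz` (kernels `ρ ∈ 𝒦`: `C_c^∞(B₁)`, `∫ρ = 1`, `ρ ≥ 0`,
even), IF `D[u]` is independent of the choice of `ρ` — in particular whenever `u` is a weak solution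
of incompressible Euler (Duchon–Robert 2000) — THEN `|D[u]|(K) = 0` for every compact
`K ⊂ Ω × (0,T)`: local energy conservation in the Onsager-CRITICAL class `BV ∩ L^∞`. Proof:
Ambrosio's anisotropic optimisation of the kernel (Ambrosio 2004) — `|D[u]| ≤ inf_ρ (∫|∇ρ(z)·M z|dz) ν`
with `M` the trace-free polar of `∇u` (incompressibility) — and Alberti's lemma
`inf_ρ ∫ |∇ρ(z) · Mz| dz = |tr M|` (op. cit. Lemma 2.9 / §2.6). "The same approach would fail, and it
has to do so, in the compressible context. For instance, Burgers shocks enjoy the same critical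
regularity `L^∞ ∩ BV` … while having non-trivial dissipation measure" (op. cit. p. 5).

## What is vendored

* `torusTotalVariation v` (real definition): the total variation `|Dv|(T^d) ∈ [0, ∞]` of the
  distributional gradient of a field `v : T^d → ℝ^d`, `sup {∫ ∑ᵢ vᵢ div Φᵢ : Φᵢ ∈ C^∞(T^d; ℝ^d),
  ∑ᵢ|Φᵢ|² ≤ 1 pointwise}` (Ambrosio–Fusco–Pallara Def. 3.4 / Evans–Gariepy §5.1, on the torus, in
  the tree's torus calculus `Torus.IsSmooth`, `Torus.divergence`); `v ∈ BV(T^d)` iff it is finite.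
* `DeRosaInversi2024_thm12` — the NAMED FACT (D-0014), Thm. 1.2 transplanted to the flat torus
  `T^d` (the statement is local; `O ⊂⊂ Ω` becomes all of `T^d`) in the accepted Duchon–Robert
  vocabulary of `Literature.Analysis.FluidPDE.DissipationAnomaly`: the tree's
  `Torus.HasDuchonRobertDefect T u D` asks `∫₀ᵀ∫ D_ε(u) ψ → D ψ` for EVERY mollifier of
  `FluidPDE.IsMollifier` (smooth, compactly supported, even, nonnegative, mass one — a class
  containing De Rosa–Inversi's `𝒦`), so it carries the kernel-independence hypothesis of Thm. 1.2,
  and the conclusion `|D[u]|(K) = 0` for all compact `K ⊂ (0,T) × T^d` is rendered as `D ψ = 0` for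
  every smooth `ψ` compactly supported in `(0,T) × T^d` (`Torus.IsSpaceTimeTestIoo T ψ`), i.e.
  `D = 0` in `𝒟'((0,T) × T^d)`. Hypotheses as printed and guarded: `u` jointly measurable, weakly
  divergence-free at a.e. time, essentially bounded on `[a,b] × T^d` and `∫_a^b |Du(t)|(T^d) dt < ∞`
  for every `[a,b] ⊂ (0,T)`.

## Not vendored (and why)

* De Rosa–Inversi–Nesi, Nonlinearity 39 (2026) (arXiv:2412.08493), Thm. 1.3 / Cor. 1.4 (`|D|(Σ) = 0`
  on countably `H^d`-rectifiable space–time sets for `L^∞` Euler solutions with bilateral traces;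
  `SBD` solutions conserve energy): no carriers for rectifiability, bilateral traces on Lipschitz
  hypersurfaces or `SBD` in the tree/Mathlib.
* Ambrosio, Invent. Math. 158 (2004), Thm. 3.5 (renormalisation for `L¹_t BV_x` transport): a
  separate barrier (scalar side); only cited in `because:`.
* The summit-facing corollary suggested by the requesting item — an `L^∞`-bounded vanishing-viscosity
  Leray–Hopf family with bounded mean total variation `sup_ν ⟨|Du^ν|(T³)⟩ < ∞` has mean dissipation
  `→ 0` (Thm. 1.2 × Duchon–Robert 2000 Prop. 4 × `BV ⊂⊂ L¹` × Aubin–Lions) — is NOT printed in any of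
  the sources; it is recorded in `blocks:` as the mechanism by which the fact bears on the summit and
  must be proved (from this fact and the tree's Duchon–Robert inviscid-limit files) before it may be
  asserted.

## References

* [DeRosaInversi2024] L. De Rosa, M. Inversi, Comm. Math. Phys. 405 (2024), Thm. 1.2 (arXiv:2307.09189).
* [DeRosaInversiNesi2026] L. De Rosa, M. Inversi, M. Nesi, Nonlinearity (2026), Thm. 1.3, Cor. 1.4.
* [Ambrosio2004] L. Ambrosio, Invent. Math. 158 (2004), Thm. 3.5; [AmbrosioCrippa2014] §5.
* [DuchonRobert2000] J. Duchon, R. Robert, Nonlinearity 13 (2000), Prop. 2, Prop. 4.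
-/

noncomputable section

open MeasureTheory TopologicalSpace Set Function Filter Topology
open scoped InnerProductSpace RealInnerProductSpace ENNReal NNReal

namespace Literature.Barriers.AnomalousDissipation

open Literature.Analysis Literature.Analysis.FunctionSpaces Literature.Analysis.FluidPDE

variable {d : Type} [Fintype d] [DecidableEq d]

/-! ### Total variation on the torus -/

/-- The **total variation** `|Dv|(T^d) ∈ [0, ∞]` of the distributional gradient of a vector field
`v : T^d → ℝ^d` on the flat unit torus: the supremum of `∫_{T^d} ∑ᵢ vᵢ(x) div Φᵢ(x) dx` over smooth
test fields `Φᵢ : T^d → ℝ^d` (one for each component `vᵢ`) with pointwise Frobenius bound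
`∑ᵢ ‖Φᵢ(x)‖² ≤ 1`; `v ∈ BV(T^d; ℝ^d)` iff `torusTotalVariation v < ∞` (Ambrosio–Fusco–Pallara,
Def. 3.4: `V(u, Ω) = sup {∫ u div φ : φ ∈ C¹_c, ‖φ‖_∞ ≤ 1}`; De Rosa–Inversi §2.2:
"`BV(Ω) := {f ∈ L¹ : ∇f ∈ ℳ(Ω; ℝ^d)}`"). Bochner integral in `x` (junk `0` for non-integrable
`v`, so meaningful for `v ∈ L¹`, which the consumers assume). [cite: DeRosaInversi2024, §2.2] -/
def torusTotalVariation (v : UnitAddTorus d → EuclideanSpace ℝ d) : ℝ≥0∞ :=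
  ⨆ (Φ : d → UnitAddTorus d → EuclideanSpace ℝ d) (_ : ∀ i, Torus.IsSmooth (Φ i))
    (_ : ∀ x, ∑ i, ‖Φ i x‖ ^ 2 ≤ 1),
    ENNReal.ofReal (∫ x, ∑ i, v x i * Torus.divergence (Φ i) x)

/-- Every admissible family of test fields gives a lower bound for the total variation (the
defining supremum). [cite: DeRosaInversi2024, §2.2] -/
theorem ofReal_integral_le_torusTotalVariation (v : UnitAddTorus d → EuclideanSpace ℝ d)
    {Φ : d → UnitAddTorus d → EuclideanSpace ℝ d} (hΦ : ∀ i, Torus.IsSmooth (Φ i))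
    (hΦ1 : ∀ x, ∑ i, ‖Φ i x‖ ^ 2 ≤ 1) :
    ENNReal.ofReal (∫ x, ∑ i, v x i * Torus.divergence (Φ i) x) ≤ torusTotalVariation v :=
  le_iSup_of_le Φ (le_iSup_of_le hΦ (le_iSup_of_le hΦ1 le_rfl))

/-! ### The named fact -/

/-- **De Rosa–Inversi 2024, Thm. 1.2 (energy conservation in `BV ∩ L^∞`), on the flat torus.**
Let `T > 0` and let `u : (0,T) × T^d → ℝ^d` be jointly measurable, weakly divergence-free at
a.e. time, and locally of class `L¹_t BV_x ∩ L^∞_{t,x}`: for every `[a,b] ⊂ (0,T)`, `u` is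
essentially bounded on `[a,b] × T^d` and `∫_a^b |Du(t)|(T^d) dt < ∞`. If `D` is a Duchon–Robert
defect of `u` on `(0,T)` in the sense of `Torus.HasDuchonRobertDefect` — the distributional limit of
`D_ε(u)`, the SAME for every smooth even nonnegative compactly supported unit-mass mollifier
(kernel-independence, automatic for weak Euler solutions by Duchon–Robert 2000) — then `D` vanishes:
`D ψ = 0` for every smooth `ψ` compactly supported in `(0,T) × T^d` (printed: `|D[u]|(K) = 0` for
every compact `K ⊂ Ω × (0,T)`, for `Ω ⊂ ℝ^d` open; transplanted to `T^d`, the statement being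
local). Mechanism: Ambrosio's anisotropic kernel optimisation and Alberti's lemma with the
trace-free polar of `∇u`; fails, as it must, for compressible `BV ∩ L^∞` fields (Burgers shocks).

BARRIER (D-0021):
- technique_class: codimension-one-singularities vortex-sheets shocks bounded-bv-witnesses burgers-phenomenology
- blocks: any mechanism for `Literature.Turb.ZerothLaw` (= `AnomalousDissipation`) or for the finite-window questions `Literature.Analysis.FluidPDE.BrueDeLellisQuestion21` / `BrueDeLellisQuestion22` whose inviscid-limit dissipation is to be carried by a limiting Euler field of class `L¹_t BV_x ∩ L^∞_{t,x}` — vortex sheets, tangential discontinuities, shock-like ("Burgers") fronts, piecewise-smooth fields with jump sets: the Duchon–Robert measure of such a field vanishes identically [cite: DeRosaInversi2024, Thm. 1.2], so by the Duchon–Robert inviscid-limit identification of the anomaly with `D[u]` (strong `L³` compactness) [cite: DuchonRobert2000, Prop. 4] an `L^∞`-bounded witness family can be anomalous only if its mean total variation `⟨|Du^ν|(T³)⟩` (equivalently, by the coarea formula, the mean area of iso-velocity surfaces) diverges as `ν → 0` — the symmetry-free analogue of `Literature.Barriers.AnomalousDissipation.ShearFlowViscositySelection`; this corollary is the mechanism,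 NOT a vendored statement (see module docstring).
- because: `|D[u]| ≤ inf_{ρ ∈ 𝒦} (∫_{B₁} |∇ρ(z) · M_{x,t} z| dz) ν` with `ν ≈ |∇u|` and `M_{x,t}` the polar of `∇u` w.r.t. `|∇u|`, trace-free by `div u = 0` (Ambrosio's anisotropic optimisation [cite: Ambrosio2004, Thm. 3.5]; [cite: DeRosaInversi2024, (1.9) and Lemma 2.10]), and Alberti's lemma `inf_ρ ∫|∇ρ(z)·Mz|dz = |tr M| = 0` [cite: DeRosaInversi2024, Lemma 2.9 (§2.6)]; the `BV` increment estimate `∫|δ_z u| ≤ |z| |Du|` makes `BV ∩ L^∞` Onsager-critical [cite: DeRosaInversi2024, Lemma 2.2 and Thm. 1.1].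
- evasions_known: dissipation must live on sets that are not countably `H^d`-rectifiable in space–time / fields outside `L¹_t BV_x` (genuinely fractal or "`1/3`-Hölder-everywhere" singular supports): for `L^∞` Euler solutions with bilateral traces `|D|(Σ) = 0` on every countably rectifiable `Σ` and `SBD` solutions conserve energy [cite: DeRosaInversiNesi2026, Thm. 1.3 and Cor. 1.4]; compressible models evade (Burgers shocks dissipate in `BV ∩ L^∞`) [cite: DeRosaInversi2024, Rem. after Thm. 1.2]; lower bounds on the dimension of the dissipation support [cite: DeRosaDrivasInversi2024, Thm. 1.1] (`Literature.Barriers.AnomalousDissipation.DissipationSupportLowerBound`).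
- scope_caveats: the fact is about ONE field `u` (a putative inviscid limit), not about Leray–Hopf families: turning it into "bounded mean total variation ⇒ no anomaly" needs strong compactness of the family and the Duchon–Robert limit theorem, not vendored here; kernel-independence is a hypothesis (automatic only for weak Euler solutions with `p ∈ L¹_loc`); interior/local statement (`|D|(K) = 0` on compacts of `Ω × (0,T)`; on bounded domains energy conservation needs the normal-trace condition of Thm. 1.3); nothing is said about `L¹_t BD_x` except for radial kernels [cite: DeRosaInversi2024, Thm. 1.2, Thm. 1.3 and Rem. 4.1].
- status: established (theorem) [cite: DeRosaInversi2024, Thm. 1.2] -/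
def DeRosaInversi2024_thm12 : Prop :=
  ∀ (d : Type) [Fintype d] [DecidableEq d] (T : ℝ) (u : ℝ → UnitAddTorus d → EuclideanSpace ℝ d)
    (D : Torus.STFunctional d), 0 < T →
    AEStronglyMeasurable (Torus.stLift u) (volume.restrict (Ioo 0 T ×ˢ univ)) →
    (∀ᵐ t ∂(volume.restrict (Ioo 0 T)), Torus.IsWeaklyDivFree (u t)) →
    (∀ a b : ℝ, 0 < a → a ≤ b → b < T →
      ∃ M : ℝ, ∀ᵐ t ∂(volume.restrict (Icc a b)), ∀ᵐ x : UnitAddTorus d, ‖u t x‖ ≤ M) →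
    (∀ a b : ℝ, 0 < a → a ≤ b → b < T → ∫⁻ t in Icc a b, torusTotalVariation (u t) < ⊤) →
    Torus.HasDuchonRobertDefect T u D →
    ∀ ψ : ℝ → UnitAddTorus d → ℝ, Torus.IsSpaceTimeTestIoo T ψ → D ψ = 0

namespace DeRosaInversi2024_thm12

/-- Under the hypotheses of the fact the defect functional agrees with the zero functional on all
admissible test functions; in particular any two Duchon–Robert defects of such a field vanish
together (uniqueness `Torus.HasDuchonRobertDefect.unique` is not even needed).
[cite: DeRosaInversi2024, Thm. 1.2] -/
theorem eq_zero_apply (h : DeRosaInversi2024_thm12) {d : Type} [Fintype d] [DecidableEq d] {T : ℝ}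
    {u : ℝ → UnitAddTorus d → EuclideanSpace ℝ d} {D : Torus.STFunctional d} (hT : 0 < T)
    (hmeas : AEStronglyMeasurable (Torus.stLift u) (volume.restrict (Ioo 0 T ×ˢ univ)))
    (hdiv : ∀ᵐ t ∂(volume.restrict (Ioo 0 T)), Torus.IsWeaklyDivFree (u t))
    (hbdd : ∀ a b : ℝ, 0 < a → a ≤ b → b < T →
      ∃ M : ℝ, ∀ᵐ t ∂(volume.restrict (Icc a b)), ∀ᵐ x : UnitAddTorus d, ‖u t x‖ ≤ M)
    (hBV : ∀ a b : ℝ, 0 < a → a ≤ b → b < T → ∫⁻ t in Icc a b, torusTotalVariation (u t) < ⊤)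
    (hD : Torus.HasDuchonRobertDefect T u D) {ψ : ℝ → UnitAddTorus d → ℝ}
    (hψ : Torus.IsSpaceTimeTestIoo T ψ) : D ψ = 0 :=
  h d T u D hT hmeas hdiv hbdd hBV hD ψ hψ

/-- **No anomalous Duchon–Robert flux for globally bounded `L¹_t BV_x` fields** (the global-in-time
form consumers meet: `u ∈ L^∞((0,T) × T^d)` and `∫₀ᵀ |Du(t)| dt < ∞` imply the local hypotheses).
[cite: DeRosaInversi2024, Thm. 1.2] -/
theorem of_global (h : DeRosaInversi2024_thm12) {d : Type} [Fintype d] [DecidableEq d] {T : ℝ}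
    {u : ℝ → UnitAddTorus d → EuclideanSpace ℝ d} {D : Torus.STFunctional d} (hT : 0 < T)
    (hmeas : AEStronglyMeasurable (Torus.stLift u) (volume.restrict (Ioo 0 T ×ˢ univ)))
    (hdiv : ∀ᵐ t ∂(volume.restrict (Ioo 0 T)), Torus.IsWeaklyDivFree (u t))
    {M : ℝ} (hbdd : ∀ᵐ t ∂(volume.restrict (Ioo 0 T)), ∀ᵐ x : UnitAddTorus d, ‖u t x‖ ≤ M)
    (hBV : ∫⁻ t in Ioo 0 T, torusTotalVariation (u t) < ⊤)
    (hD : Torus.HasDuchonRobertDefect T u D) {ψ : ℝ → UnitAddTorus d → ℝ}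
    (hψ : Torus.IsSpaceTimeTestIoo T ψ) : D ψ = 0 := by
  refine h d T u D hT hmeas hdiv (fun a b ha hab hb ↦ ⟨M, ?_⟩) (fun a b ha hab hb ↦ ?_) hD ψ hψ
  · have hsub : Icc a b ⊆ Ioo 0 T := fun t ht ↦ ⟨ha.trans_le ht.1, ht.2.trans_lt hb⟩
    exact ae_restrict_of_ae_restrict_of_subset hsub hbdd
  · have hsub : Icc a b ⊆ Ioo 0 T := fun t ht ↦ ⟨ha.trans_le ht.1, ht.2.trans_lt hb⟩
    exact lt_of_le_of_lt (lintegral_mono_set hsub) hBV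

end DeRosaInversi2024_thm12

end Literature.Barriers.AnomalousDissipation

end
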